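import Literature.Barriers.BirchSwinnertonDyer.RankNotSumOfLocalInvariants
import Literature.NumberTheory.Automorphic.GaloisActionAdeleRing
import Mathlib.NumberTheory.Cyclotomic.Basic
import HarnessLib

/-!
# Barrier (BirchSwinnertonDyer): the rank modulo `n` is not a sum of local invariants — proofs

Companion to `Literature/Barriers/BirchSwinnertonDyer/RankNotSumOfLocalInvariants.lean`, whose
barrier `Literature.Barriers.BirchSwinnertonDyer.DokchitserDokchitser2011_rankMod_notSumOfLocalInvariants` is Theorem 2 of
T. Dokchitser–V. Dokchitser, *A note on the Mordell–Weil rank modulo `n`*, J. Number Theory 131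
(2011) 1833–1839 (arXiv:0910.4588): "For `n ∈ {3,4,5}` the Mordell–Weil rank modulo `n` is not a
sum of local invariants (with values in `ℤ/nℤ`)." The printed proof has two ingredients:

* **Lemma 3** (the mechanism): "Suppose `Λ : (number fields) → ℤ/nℤ` satisfies
  `Λ(K) = ∑_v λ(K_v)` for some function `λ : (local fields) → ℤ/nℤ`. Then `Λ(F) = 0` whenever
  `F/K` is a Galois extension of number fields in which the number of places above each place of
  `K` is a multiple of `n`. *Proof.* In the local expression for `Λ(F)` each local field occurs a
  multiple of `n` times."
* **Proof of Theorem 2** (the computation): for `E/ℚ : y² = x(x+2)(x-3)` (`480a1`) and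
  `F₃` = the degree-9 subfield of `ℚ(ζ₁₃, ζ₁₀₃)`, `F₅` = the degree-25 subfield of
  `ℚ(ζ₁₁, ζ₂₄₁)`, `F₄ = ℚ(√-1, √41, √73)`: "Because 13 and 103 are cubes modulo one another, and
  all other primes are unramified in `F₃`, every place of `ℚ` splits into 3 or 9 in `F₃`.
  Similarly `F₄` and `F₅` also satisfy the assumptions of Lemma 3 with `n = 4, 5`. […] However,
  2-descent shows that `rk E/F₃ = rk E/F₅ = 1` and `rk E/F₄ = 6` (e.g. using Magma, over all
  minimal non-trivial subfields of `F_n`)."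

This file PROVES Lemma 3 in the formal setting of the barrier file (`LocalInvariant`,
`LocalInvariant.localSum`: sum over `v : HeightOneSpectrum (𝓞 F)` with `F_v = v.adicCompletion F`
and over `v : InfinitePlace F` with `F_v = v.Completion`) and REDUCES Theorem 2 to the three
descent computations, vendored as named facts. Source item → Lean declaration → status:

| source (DokchitserDokchitser2011RankModN) | declaration | status |
|---|---|---|
| Lemma 3, proof ("each local field occurs a multiple of `n` times") | `finsum_eq_nsmul_of_dvd_card_fiber` | proved |
| Lemma 3 (Galois conjugate places give the same local term) | `LocalInvariant.apply_adicCompletion_eq_of_under_eq`, `LocalInvariant.apply_completion_eq_of_comap_eq` | proved |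
| Lemma 3 | `LocalInvariant.localSum_baseChange_eq_nsmul` (any `A`), `LocalInvariant.localSum_baseChange_eq_zero` (`A = ℤ/nℤ`) | proved |
| proof of Thm. 2: the curve `480a1 : y² = x(x+2)(x-3)` | `curve480a1` (+ `IsElliptic` instance, `Δ = 14400`) | definition |
| proof of Thm. 2: `F₃`, splitting, `rk E/F₃ = 1` (2-descent, Magma) | `DokchitserDokchitser2011_rank_480a1_F3` | named fact |
| proof of Thm. 2: `F₄`, splitting, `rk E/F₄ = 6` (2-descent, Magma) | `DokchitserDokchitser2011_rank_480a1_F4` | named fact |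
| proof of Thm. 2: `F₅`, splitting, `rk E/F₅ = 1` (2-descent, Magma) | `DokchitserDokchitser2011_rank_480a1_F5` | named fact |
| proof of Thm. 2: "it would be `0 ∈ ℤ/nℤ` for `E/F_n`" (one witness refutes a local formula mod `n`) | `not_isSumOfLocalInvariants_rankInvariant_of_witness` | proved |
| Thm. 2 from the three computations | `DokchitserDokchitser2011_rankMod_notSumOfLocalInvariants_of_descent` | proved |
| Lemma 3 over `ℤ` as a denominator chase: `n ∣ m · rk E(F)` (Remark 14, "multiplying the formula by `m`") | `natCast_dvd_mul_mordellWeilRank_of_isSumOfLocalInvariants` | proved |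
| Remark 14 (denominators), unconditional part: local terms in `(1/m)ℤ` force `30 ∣ m` | `thirty_dvd_of_isSumOfLocalInvariants_mul_rank` | proved |

Why the barrier itself (`theorem …_holds`) is not assembled here: the formal statement is refuted
only by exhibiting an elliptic curve over a number field whose Mordell–Weil rank
(`WeierstrassCurve.mordellWeilRank = Module.finrank ℤ E(F)`) is provably `≢ 0 (mod n)` — `λ = 0`
is otherwise a local formula — and no Mordell–Weil rank is computable in Lean today (Mathlib has
neither the Mordell–Weil theorem, tree fact `WeierstrassCurve.module_finite_point`, nor any
descent); the printed ranks are Magma 2-descents over fields of degree 9, 25 and 8. The three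
named facts are exactly these leaves; everything else in the printed proof is proved below.

Coefficients (barrier audit of this file, 2026-08-15). Theorem 1 concerns `ℤ`-valued local
terms. A formula `rk E/K = ∑_v λ(E/K_v)` with `λ` valued in `(1/m)ℤ` is a `ℤ`-valued formula
for `m · rk`, and the three printed computations exclude it exactly when `30 ∤ m`
(`thirty_dvd_of_isSumOfLocalInvariants_mul_rank`: Lemma 3 with `A = ℤ` over `F₃, F₄, F₅` gives
`3 ∣ m`, `4 ∣ 6m`, `5 ∣ m`); local terms in `(1/30)ℤ`, or `ℚ`-valued with unbounded
denominators, are NOT excluded unconditionally — for a divisible coefficient group Lemma 3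
(`Λ(F) = n • a`) is void — and loc. cit., Remark 14 ("introducing a denominator does not appear
to help … by increasing `d` by `k`") disposes of bounded denominators only through the
CONDITIONAL Theorems 9 and 13. (The fixed-base-field reach of the barrier is audited in
`RankNotSumOfLocalInvariants.lean`, § Audit 2026-08-15.)

Galois transport of completions (`σ : F_w ≃+* F_{σ w}`, bicontinuous, fixing `K`) is the tree's
`Literature.NumberTheory.Automorphic.galAdicCompletionEquiv` / `galInfiniteCompletionEquiv`
(`Literature/NumberTheory/Automorphic/GaloisActionPlaces.lean`, `GaloisActionAdeleRing.lean`,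
Cassels–Fröhlich Ch. VII §1.1), transitivity of `Gal(F/K)` on the places above a place of `K` is
Mathlib's `Ideal.exists_smul_eq_of_isGaloisGroup` (via `Literature.Automorphic.HeightOneSpectrum.
exists_algEquiv_smul_eq`) and `NumberField.InfinitePlace.exists_smul_eq_of_comap_eq`.

Design notes.
* Fibres are counted with `Nat.card {w // w.under (𝓞 K) = v}` and
  `Nat.card {w // w.comap (algebraMap K F) = v}`; both subtypes are finite (Mathlib
  `IsDedekindDomain.primesOver_finite`, `Fintype (InfinitePlace F)`), so `Nat.card` is the honest
  number of places above `v` (no junk `0`). The abstract counting lemma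
  `finsum_eq_nsmul_of_dvd_card_fiber` is nevertheless stated and proved for arbitrary fibres: an
  infinite fibre on which a finitely supported fibre-constant function does not vanish cannot occur.
* The witness fields enter the named facts existentially (`∃ F : Type, …`) but pinned down, up to
  isomorphism, by the printed description: degree `9` inside `ℚ(ζ₁₃, ζ₁₀₃) = ℚ(ζ₁₃₃₉)` (the
  degree-9 subfield is unique: the Galois group `(ℤ/1339)ˣ ≅ C₁₂ × C₁₀₂` has a unique quotient of
  order `9`), degree `25` inside `ℚ(ζ₁₁, ζ₂₄₁) = ℚ(ζ₂₆₅₁)` (likewise), degree `8` containing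
  `√-1, √41, √73`. "The number of places above each place of `ℚ` is a multiple of `n`" is stated
  for the finite places `v : HeightOneSpectrum (𝓞 ℚ)` and the infinite place(s)
  `v : InfinitePlace ℚ` alike, exactly the hypotheses of the formal Lemma 3.
* No `sorry`, no new instances except `curve480a1.instIsElliptic` (a concrete curve).

## References

* T. Dokchitser, V. Dokchitser, *A note on the Mordell–Weil rank modulo `n`*, J. Number Theory
  131 (2011) 1833–1839, arXiv:0910.4588: §1 "Mordell–Weil rank is not a sum of local
  invariants" — Definition, Thm. 2, Lemma 3 with proof, proof of Thm. 2 (p. 3 of the held arXiv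
  copy). [DokchitserDokchitser2011RankModN]
* J. W. S. Cassels, A. Fröhlich (eds.), *Algebraic Number Theory* (1967), Ch. VII §1.1 (action of
  the Galois group on places and completions). [CasselsFrohlichANT1967]
-/

noncomputable section

open scoped Classical NumberField

open NumberField IsDedekindDomain WeierstrassCurve

namespace Literature.Barriers.BirchSwinnertonDyer

/-! ### "Each local field occurs a multiple of `n` times": the counting lemma -/

/-- **Counting lemma behind Lemma 3.** If `f : X → A` has finite support, is constant on the
fibres of `π : X → Y`, and every fibre of `π` has cardinality divisible by `n`, then
`∑ᶠ x, f x` is `n • a` for some `a` ("in the local expression each local field occurs a multiple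
of `n` times"). Fibres meeting the support lie inside it, hence are finite, so `Nat.card` is their
true size; other fibres contribute `0`. [cite: DokchitserDokchitser2011RankModN, Lemma 3 (proof)] -/
theorem finsum_eq_nsmul_of_dvd_card_fiber {X Y A : Type*} [AddCommMonoid A] (π : X → Y)
    (f : X → A) (n : ℕ) (hfin : (Function.support f).Finite)
    (hconst : ∀ x x', π x = π x' → f x = f x') (hdvd : ∀ y, n ∣ Nat.card {x // π x = y}) :
    ∃ a : A, ∑ᶠ x, f x = n • a := by
  classical
  set s := hfin.toFinset with hs
  have hsum : ∑ᶠ x, f x = ∑ y ∈ s.image π, ∑ x ∈ s with π x = y, f x := by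
    rw [finsum_eq_sum_of_support_subset f (s := s) (by simp [hs])]
    exact (Finset.sum_fiberwise_of_maps_to (fun x hx => Finset.mem_image_of_mem π hx) f).symm
  have key : ∀ y ∈ s.image π, ∃ b : A, ∑ x ∈ s with π x = y, f x = n • b := by
    intro y hy
    obtain ⟨x₀, hx₀, rfl⟩ := Finset.mem_image.mp hy
    have hfx₀ : f x₀ ≠ 0 := by simpa [hs] using hx₀
    have hfib : ({x | π x = π x₀} : Set X).Finite :=
      hfin.subset fun x (hx : π x = π x₀) => by
        rw [Function.mem_support, hconst x x₀ hx]
        exact hfx₀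
    have hfilter : (s.filter fun x => π x = π x₀) = hfib.toFinset := by
      ext x
      simp only [hs, Finset.mem_filter, Set.Finite.mem_toFinset, Function.mem_support,
        Set.mem_setOf_eq, and_iff_right_iff_imp]
      intro hx
      rw [hconst x x₀ hx]
      exact hfx₀
    obtain ⟨k, hk⟩ := hdvd (π x₀)
    refine ⟨k • f x₀, ?_⟩
    rw [hfilter, Finset.sum_congr rfl fun x hx => hconst x x₀ (by simpa using hx), Finset.sum_const,
      ← Nat.card_eq_card_finite_toFinset hfib, ← mul_nsmul']
    exact congrArg (· • f x₀) hk
  choose! b hb using key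
  exact ⟨∑ y ∈ s.image π, b y, by rw [hsum, Finset.smul_sum]; exact Finset.sum_congr rfl hb⟩

/-! ### Lemma 3: conjugate places give equal local terms, so fibres contribute multiples of `n` -/

section Lemma3

open Literature.NumberTheory.Automorphic

variable {A : Type}

/-- **Conjugate infinite places give the same local term.** For a Galois extension `F/K`, an
elliptic curve (Weierstrass model `W`) over `K` and a local invariant `λ`, the value `λ(E/F_w)` at
an infinite place `w` of `F` only depends on the place of `K` below `w`: two such places are
conjugate under some `σ ∈ Gal(F/K)` (Mathlib
`NumberField.InfinitePlace.exists_smul_eq_of_comap_eq`), `σ` extends to a bicontinuous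
isomorphism `F_w ≃+* F_{σ w}` fixing `K` (tree
`Literature.NumberTheory.Automorphic.galInfiniteCompletionEquiv`, Cassels–Fröhlich VII §1.1), which carries `E/F_w`
to `E/F_{σ w}`, and `λ` is an isomorphism invariant.
[cite: DokchitserDokchitser2011RankModN, Lemma 3 (proof)]
[cite: CasselsFrohlichANT1967, Ch. VII §1.1] -/
theorem LocalInvariant.apply_completion_eq_of_comap_eq {K F : Type} [Field K] [Field F]
    [Algebra K F] [IsGalois K F] (lam : LocalInvariant A) (W : WeierstrassCurve K)
    {w w' : InfinitePlace F} (h : w.comap (algebraMap K F) = w'.comap (algebraMap K F)) :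
    lam.toFun w'.Completion ((W.baseChange F).baseChange w'.Completion) =
      lam.toFun w.Completion ((W.baseChange F).baseChange w.Completion) := by
  obtain ⟨σ, hσ⟩ := NumberField.InfinitePlace.exists_smul_eq_of_comap_eq h
  have key : ((W.baseChange F).baseChange w.Completion).map
      (galInfiniteCompletionEquiv σ hσ).toRingHom = (W.baseChange F).baseChange w'.Completion := by
    simp only [WeierstrassCurve.baseChange, WeierstrassCurve.map_map]
    congr 1
    refine RingHom.ext fun a => ?_
    change galInfiniteCompletionMap σ hσ ((algebraMap K F a : F) : w.Completion) =
      ((algebraMap K F a : F) : w'.Completion)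
    rw [galInfiniteCompletionMap_coe, AlgEquiv.commutes]
  rw [← key, lam.apply_map _ _ (galInfiniteCompletionEquiv σ hσ)
    (continuous_galInfiniteCompletionMap K σ hσ)
    (continuous_galInfiniteCompletionMap K σ⁻¹ (InfinitePlace.inv_smul_eq_of_smul_eq hσ))]

variable (K F : Type) [Field K] [NumberField K] [Field F] [NumberField F] [Algebra K F]

/-- **Conjugate finite places give the same local term.** For a Galois extension `F/K` of number
fields, an elliptic curve (Weierstrass model `W`) over `K` and a local invariant `λ`, the value
`λ(E/F_w)` only depends on the place of `K` below `w`: two places `w, w'` over the same `v` are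
conjugate under some `σ ∈ Gal(F/K)` (Mathlib `Ideal.exists_smul_eq_of_isGaloisGroup`), `σ`
extends to a bicontinuous isomorphism `F_w ≃+* F_{w'}` fixing `K` (tree
`Literature.NumberTheory.Automorphic.galAdicCompletionEquiv`, Cassels–Fröhlich VII §1.1), which carries `E/F_w` to
`E/F_{w'}`, and `λ` is an isomorphism invariant. This is the content of "each local field occurs
a multiple of `n` times" at the finite places.
[cite: DokchitserDokchitser2011RankModN, Lemma 3 (proof)]
[cite: CasselsFrohlichANT1967, Ch. VII §1.1] -/
theorem LocalInvariant.apply_adicCompletion_eq_of_under_eq [IsGalois K F] (lam : LocalInvariant A)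
    (W : WeierstrassCurve K) {w w' : HeightOneSpectrum (𝓞 F)}
    (h : w.under (𝓞 K) = w'.under (𝓞 K)) :
    lam.toFun (w'.adicCompletion F) ((W.baseChange F).baseChange (w'.adicCompletion F)) =
      lam.toFun (w.adicCompletion F) ((W.baseChange F).baseChange (w.adicCompletion F)) := by
  obtain ⟨σ, hσ⟩ := Literature.NumberTheory.Automorphic.HeightOneSpectrum.exists_algEquiv_smul_eq K h
  have key : ((W.baseChange F).baseChange (w.adicCompletion F)).map
      (galAdicCompletionEquiv σ hσ).toRingHom =
        (W.baseChange F).baseChange (w'.adicCompletion F) := by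
    simp only [WeierstrassCurve.baseChange, WeierstrassCurve.map_map]
    congr 1
    refine RingHom.ext fun a => ?_
    change galAdicCompletionMap σ hσ ((algebraMap K F a : F) : w.adicCompletion F) =
      ((algebraMap K F a : F) : w'.adicCompletion F)
    exact galAdicCompletionMap_algebraMap K σ hσ a
  rw [← key, lam.apply_map _ _ (galAdicCompletionEquiv σ hσ)
    (continuous_galAdicCompletionEquiv F σ hσ) (continuous_galAdicCompletionEquiv_symm F σ hσ)]

variable [AddCommMonoid A]

/-- **Lemma 3 (Dokchitser–Dokchitser 2011), general coefficients.** Let `λ` be a local invariant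
with values in an abelian group `A`, `F/K` a Galois extension of number fields in which the number
of places above each place of `K` — finite (`v : HeightOneSpectrum (𝓞 K)`, fibre
`{w // w.under (𝓞 K) = v}`) and infinite (`v : InfinitePlace K`, fibre
`{w // w.comap (algebraMap K F) = v}`) — is a multiple of `n`, and `E` an elliptic curve over `K`
(model `W`) for which `λ(E/F_w) = 0` for all but finitely many `w`. Then the local sum
`∑_w λ(E/F_w)` over all places of `F` is `n • a` for some `a ∈ A`: "in the local expression for
`Λ(F)` each local field occurs a multiple of `n` times" (conjugate places give equal terms,
`apply_adicCompletion_eq_of_under_eq` / `apply_completion_eq_of_comap_eq`, and each fibre has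
size `≡ 0 mod n`, `finsum_eq_nsmul_of_dvd_card_fiber`). The printed lemma is the case
`A = ℤ/nℤ` (`localSum_baseChange_eq_zero`). [cite: DokchitserDokchitser2011RankModN, Lemma 3] -/
theorem LocalInvariant.localSum_baseChange_eq_nsmul [IsGalois K F] (lam : LocalInvariant A)
    (n : ℕ) (W : WeierstrassCurve K)
    (hfin : (Function.support fun w : HeightOneSpectrum (𝓞 F) ↦
      lam.toFun (w.adicCompletion F) ((W.baseChange F).baseChange (w.adicCompletion F))).Finite)
    (h₁ : ∀ v : HeightOneSpectrum (𝓞 K),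
      n ∣ Nat.card {w : HeightOneSpectrum (𝓞 F) // w.under (𝓞 K) = v})
    (h₂ : ∀ v : InfinitePlace K,
      n ∣ Nat.card {w : InfinitePlace F // w.comap (algebraMap K F) = v}) :
    ∃ a : A, lam.localSum F (W.baseChange F) = n • a := by
  obtain ⟨a, ha⟩ := finsum_eq_nsmul_of_dvd_card_fiber
    (fun w : HeightOneSpectrum (𝓞 F) ↦ w.under (𝓞 K))
    (fun w ↦ lam.toFun (w.adicCompletion F) ((W.baseChange F).baseChange (w.adicCompletion F)))
    n hfin (fun w w' hw ↦ (lam.apply_adicCompletion_eq_of_under_eq K F W hw).symm) h₁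
  obtain ⟨b, hb⟩ := finsum_eq_nsmul_of_dvd_card_fiber
    (fun w : InfinitePlace F ↦ w.comap (algebraMap K F))
    (fun w ↦ lam.toFun w.Completion ((W.baseChange F).baseChange w.Completion))
    n (Set.toFinite _) (fun w w' hw ↦ (lam.apply_completion_eq_of_comap_eq W hw).symm) h₂
  refine ⟨a + b, ?_⟩
  rw [LocalInvariant.localSum, ha, ← finsum_eq_sum_of_fintype, hb, nsmul_add]

/-- **Lemma 3 (Dokchitser–Dokchitser 2011), as printed** (`A = ℤ/nℤ`): if `Λ(E/F) = ∑_w λ(E/F_w)`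
with `λ` taking values in `ℤ/nℤ`, then `Λ(E/F) = 0` whenever `E` is defined over `K` and `F/K` is
a Galois extension of number fields in which the number of places above each place of `K` is a
multiple of `n`. [cite: DokchitserDokchitser2011RankModN, Lemma 3] -/
theorem LocalInvariant.localSum_baseChange_eq_zero [IsGalois K F] {n : ℕ}
    (lam : LocalInvariant (ZMod n)) (W : WeierstrassCurve K)
    (hfin : (Function.support fun w : HeightOneSpectrum (𝓞 F) ↦
      lam.toFun (w.adicCompletion F) ((W.baseChange F).baseChange (w.adicCompletion F))).Finite)
    (h₁ : ∀ v : HeightOneSpectrum (𝓞 K),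
      n ∣ Nat.card {w : HeightOneSpectrum (𝓞 F) // w.under (𝓞 K) = v})
    (h₂ : ∀ v : InfinitePlace K,
      n ∣ Nat.card {w : InfinitePlace F // w.comap (algebraMap K F) = v}) :
    lam.localSum F (W.baseChange F) = 0 := by
  obtain ⟨a, ha⟩ := lam.localSum_baseChange_eq_nsmul K F n W hfin h₁ h₂
  rw [ha, nsmul_eq_mul, ZMod.natCast_self, zero_mul]

end Lemma3

/-! ### Theorem 2 from the descent computations -/

/-- **One witness refutes a local formula modulo `n`** (the shape of the proof of Theorem 2): if
some number field `F`, Galois over `ℚ`, has a multiple of `n` places above every place of `ℚ`,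
and some elliptic curve `E/ℚ` has `rk E(F) ≢ 0 (mod n)`, then the Mordell–Weil rank modulo `n`
is not a sum of local invariants — by Lemma 3 (`LocalInvariant.localSum_baseChange_eq_zero`) any
local formula would give `rk E(F) ≡ 0 (mod n)`.
[cite: DokchitserDokchitser2011RankModN, proof of Thm. 2] -/
theorem not_isSumOfLocalInvariants_rankInvariant_of_witness (n : ℕ) (F : Type) [Field F]
    [NumberField F] [IsGalois ℚ F] (W : WeierstrassCurve ℚ) [W.IsElliptic]
    (h₁ : ∀ v : HeightOneSpectrum (𝓞 ℚ),
      n ∣ Nat.card {w : HeightOneSpectrum (𝓞 F) // w.under (𝓞 ℚ) = v})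
    (h₂ : ∀ v : InfinitePlace ℚ,
      n ∣ Nat.card {w : InfinitePlace F // w.comap (algebraMap ℚ F) = v})
    (hr : ((W.baseChange F).mordellWeilRank : ZMod n) ≠ 0) :
    ¬ IsSumOfLocalInvariants (rankInvariant (ZMod n)) := by
  rintro ⟨lam, hfin, hsum⟩
  haveI : (W.baseChange F).IsElliptic := inferInstanceAs (W.map (algebraMap ℚ F)).IsElliptic
  apply hr
  rw [← rankInvariant_apply (ZMod n) F (W.baseChange F), hsum F (W.baseChange F)]
  exact lam.localSum_baseChange_eq_zero ℚ F W (hfin F (W.baseChange F)) h₁ h₂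

/-- **The curve `480a1`** (Cremona label), `E : y² = x(x+2)(x-3) = x³ - x² - 6x` over `ℚ`, i.e.
the Weierstrass model `[a₁, a₂, a₃, a₄, a₆] = [0, -1, 0, -6, 0]` (discriminant `14400 = 2⁶·3²·5²`);
the curve used in the proof of Theorem 2.
[cite: DokchitserDokchitser2011RankModN, proof of Thm. 2] -/
def curve480a1 : WeierstrassCurve ℚ :=
  ⟨0, -1, 0, -6, 0⟩

/-- `480a1` is an elliptic curve: `Δ = 14400 ≠ 0`. [folklore] -/
instance curve480a1.instIsElliptic : curve480a1.IsElliptic where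
  isUnit := by
    rw [isUnit_iff_ne_zero]
    norm_num [curve480a1, WeierstrassCurve.Δ, WeierstrassCurve.b₂, WeierstrassCurve.b₄,
      WeierstrassCurve.b₆, WeierstrassCurve.b₈]

/-- **Descent computation, `n = 3`** (named fact; proof of Theorem 2 of Dokchitser–Dokchitser
2011). Let `F₃` be the degree-`9` subfield of `ℚ(ζ₁₃, ζ₁₀₃)` (`= ℚ(ζ₁₃₃₉)`; it is Galois over
`ℚ`). "Because 13 and 103 are cubes modulo one another, and all other primes are unramified in
`F₃`, every place of `ℚ` splits into 3 or 9 in `F₃`" — so the number of places of `F₃` above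
each place of `ℚ` (finite or infinite) is a multiple of `3` — and "2-descent shows that
`rk E/F₃ = 1`" for `E = 480a1` ("e.g. using Magma, over all minimal non-trivial subfields").
Formally: some number field `F : Type`, Galois over `ℚ`, of degree `9`, embeddable in
`ℚ(ζ₁₃₃₉)` (this pins down `F ≅ F₃`), with `3 ∣ #{w above v}` for every place `v` of `ℚ`, has
`rank_ℤ E(F) = 1` (`WeierstrassCurve.mordellWeilRank`, i.e. `finrank ℤ E(F)`). A Magma 2-descent,
not reproducible in Lean (no Mordell–Weil theorem, no descent in Mathlib): vendored as a fact.
[cite: DokchitserDokchitser2011RankModN, proof of Thm. 2] -/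
def DokchitserDokchitser2011_rank_480a1_F3 : Prop :=
  ∃ (F : Type) (_ : Field F) (_ : NumberField F),
    IsGalois ℚ F ∧ Module.finrank ℚ F = 9 ∧ Nonempty (F →ₐ[ℚ] CyclotomicField 1339 ℚ) ∧
    (∀ v : HeightOneSpectrum (𝓞 ℚ),
      3 ∣ Nat.card {w : HeightOneSpectrum (𝓞 F) // w.under (𝓞 ℚ) = v}) ∧
    (∀ v : InfinitePlace ℚ, 3 ∣ Nat.card {w : InfinitePlace F // w.comap (algebraMap ℚ F) = v}) ∧
    (curve480a1.baseChange F).mordellWeilRank = 1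

/-- **Descent computation, `n = 4`** (named fact; proof of Theorem 2 of Dokchitser–Dokchitser
2011). Let `F₄ = ℚ(√-1, √41, √73)` (degree `8`, Galois over `ℚ`). "`F₄` [satisfies] the
assumptions of Lemma 3 with `n = 4`" — the number of places of `F₄` above each place of `ℚ` is a
multiple of `4` — and "2-descent shows that `rk E/F₄ = 6`" for `E = 480a1`. Formally: some number
field `F : Type`, Galois over `ℚ`, of degree `8`, containing square roots of `-1`, `41` and `73`
(this pins down `F ≅ F₄`), with `4 ∣ #{w above v}` for every place `v` of `ℚ`, has
`rank_ℤ E(F) = 6`. A Magma 2-descent, vendored as a fact (see `…_F3`).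
[cite: DokchitserDokchitser2011RankModN, proof of Thm. 2] -/
def DokchitserDokchitser2011_rank_480a1_F4 : Prop :=
  ∃ (F : Type) (_ : Field F) (_ : NumberField F),
    IsGalois ℚ F ∧ Module.finrank ℚ F = 8 ∧
    (∃ a b c : F, a ^ 2 = -1 ∧ b ^ 2 = 41 ∧ c ^ 2 = 73) ∧
    (∀ v : HeightOneSpectrum (𝓞 ℚ),
      4 ∣ Nat.card {w : HeightOneSpectrum (𝓞 F) // w.under (𝓞 ℚ) = v}) ∧
    (∀ v : InfinitePlace ℚ, 4 ∣ Nat.card {w : InfinitePlace F // w.comap (algebraMap ℚ F) = v}) ∧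
    (curve480a1.baseChange F).mordellWeilRank = 6

/-- **Descent computation, `n = 5`** (named fact; proof of Theorem 2 of Dokchitser–Dokchitser
2011). Let `F₅` be the degree-`25` subfield of `ℚ(ζ₁₁, ζ₂₄₁)` (`= ℚ(ζ₂₆₅₁)`; Galois over `ℚ`).
"`F₅` [satisfies] the assumptions of Lemma 3 with `n = 5`" (11 and 241 are fifth powers modulo
one another) — the number of places of `F₅` above each place of `ℚ` is a multiple of `5` — and
"2-descent shows that `rk E/F₅ = 1`" for `E = 480a1`. Formally: some number field `F : Type`,
Galois over `ℚ`, of degree `25`, embeddable in `ℚ(ζ₂₆₅₁)` (this pins down `F ≅ F₅`), with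
`5 ∣ #{w above v}` for every place `v` of `ℚ`, has `rank_ℤ E(F) = 1`. A Magma 2-descent, vendored
as a fact (see `…_F3`). [cite: DokchitserDokchitser2011RankModN, proof of Thm. 2] -/
def DokchitserDokchitser2011_rank_480a1_F5 : Prop :=
  ∃ (F : Type) (_ : Field F) (_ : NumberField F),
    IsGalois ℚ F ∧ Module.finrank ℚ F = 25 ∧ Nonempty (F →ₐ[ℚ] CyclotomicField 2651 ℚ) ∧
    (∀ v : HeightOneSpectrum (𝓞 ℚ),
      5 ∣ Nat.card {w : HeightOneSpectrum (𝓞 F) // w.under (𝓞 ℚ) = v}) ∧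
    (∀ v : InfinitePlace ℚ, 5 ∣ Nat.card {w : InfinitePlace F // w.comap (algebraMap ℚ F) = v}) ∧
    (curve480a1.baseChange F).mordellWeilRank = 1

/-- **Theorem 2 of Dokchitser–Dokchitser (2011) from the three descent computations**: granting
the named facts `DokchitserDokchitser2011_rank_480a1_F3/_F4/_F5` (the fields `F₃, F₄, F₅`, their
splitting behaviour, and `rk E/F₃ = rk E/F₅ = 1`, `rk E/F₄ = 6` for `E = 480a1`), the
Mordell–Weil rank modulo `n ∈ {3, 4, 5}` is not a sum of local invariants (the barrier
`DokchitserDokchitser2011_rankMod_notSumOfLocalInvariants`): "if the Mordell–Weil rank modulo `n`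
were a sum of local invariants, it would be `0 ∈ ℤ/nℤ` for `E/F_n`" (Lemma 3), but
`1, 6, 1 ≢ 0 (mod 3, 4, 5)`. This is the printed proof with its Magma computations as the only
hypotheses. [cite: DokchitserDokchitser2011RankModN, Thm. 2 (proof)] -/
theorem DokchitserDokchitser2011_rankMod_notSumOfLocalInvariants_of_descent
    (h₃ : DokchitserDokchitser2011_rank_480a1_F3) (h₄ : DokchitserDokchitser2011_rank_480a1_F4)
    (h₅ : DokchitserDokchitser2011_rank_480a1_F5) :
    DokchitserDokchitser2011_rankMod_notSumOfLocalInvariants := by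
  intro n hn
  simp only [Finset.mem_insert, Finset.mem_singleton] at hn
  rcases hn with rfl | rfl | rfl
  · obtain ⟨F, _, _, hG, -, -, h₁, h₂, hr⟩ := h₃
    haveI := hG
    exact not_isSumOfLocalInvariants_rankInvariant_of_witness 3 F curve480a1 h₁ h₂
      (by rw [hr]; decide)
  · obtain ⟨F, _, _, hG, -, -, h₁, h₂, hr⟩ := h₄
    haveI := hG
    exact not_isSumOfLocalInvariants_rankInvariant_of_witness 4 F curve480a1 h₁ h₂
      (by rw [hr]; decide)
  · obtain ⟨F, _, _, hG, -, -, h₁, h₂, hr⟩ := h₅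
    haveI := hG
    exact not_isSumOfLocalInvariants_rankInvariant_of_witness 5 F curve480a1 h₁ h₂
      (by rw [hr]; decide)

/-! ### Denominators: which fractional local terms the three computations exclude -/

/-- **Denominator chase (Lemma 3 with integer coefficients).** If `m · rk` is a `ℤ`-valued sum of
local invariants — equivalently, `rk E/K = ∑_v λ(E/K_v)` with local terms `λ` in `(1/m)ℤ` — then
for every Galois extension of number fields `F/K` in which the number of places above each place
of `K` is a multiple of `n`, and every elliptic curve `E/K` (model `W`), `n ∣ m · rk E(F)`:
by Lemma 3 over `ℤ` (`LocalInvariant.localSum_baseChange_eq_nsmul`) the local expression for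
`m · rk E(F)` is `n • a`. With `m = 1` this is the divisibility `n ∣ rk E(F)` behind Theorems 1–2;
for general `m` it is the unconditional content of Remark 14 of loc. cit. ("multiplying the
formula by `m`"): each witness `(F, E)` with `n ∤ m · rk E(F)` excludes denominators `m`.
[cite: DokchitserDokchitser2011RankModN, Lemma 3 and Remark 14] -/
theorem natCast_dvd_mul_mordellWeilRank_of_isSumOfLocalInvariants (m : ℕ)
    (h : IsSumOfLocalInvariants
      (fun (K : Type) (_ : Field K) (_ : NumberField K) (W : WeierstrassCurve K) ↦
        (m : ℤ) * (W.mordellWeilRank : ℤ)))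
    (n : ℕ) (K F : Type) [Field K] [NumberField K] [Field F] [NumberField F] [Algebra K F]
    [IsGalois K F] (W : WeierstrassCurve K) [W.IsElliptic]
    (h₁ : ∀ v : HeightOneSpectrum (𝓞 K),
      n ∣ Nat.card {w : HeightOneSpectrum (𝓞 F) // w.under (𝓞 K) = v})
    (h₂ : ∀ v : InfinitePlace K,
      n ∣ Nat.card {w : InfinitePlace F // w.comap (algebraMap K F) = v}) :
    (n : ℤ) ∣ (m : ℤ) * ((W.baseChange F).mordellWeilRank : ℤ) := by
  obtain ⟨lam, hfin, hsum⟩ := h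
  haveI : (W.baseChange F).IsElliptic := inferInstanceAs (W.map (algebraMap K F)).IsElliptic
  obtain ⟨a, ha⟩ := lam.localSum_baseChange_eq_nsmul K F n W (hfin F (W.baseChange F)) h₁ h₂
  have e := hsum F (W.baseChange F)
  beta_reduce at e
  exact ⟨a, by rw [e, ha, nsmul_eq_mul]⟩

/-- **Local terms with denominators (Remark 14 of Dokchitser–Dokchitser 2011, unconditional
part).** A formula `rk E/K = ∑_v λ(E/K_v)` with local terms in `(1/m)ℤ` is the same thing as a
`ℤ`-valued local formula for `m · rk E/K` (multiply by `m`). Granting the three descent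
computations `DokchitserDokchitser2011_rank_480a1_F3/_F4/_F5`, such a formula forces `30 ∣ m`:
the denominator chase (`natCast_dvd_mul_mordellWeilRank_of_isSumOfLocalInvariants`) over `F₃`,
`F₄`, `F₅` gives `3 ∣ m · rk E(F₃) = m`, `4 ∣ m · rk E(F₄) = 6m` and `5 ∣ m · rk E(F₅) = m` for
`E = 480a1`. The case `m = 1` is Theorem 1 (`rank_notSumOfLocalInvariants`). Scope recorded by
the audit of this barrier: the printed unconditional data say NOTHING when `30 ∣ m` — local terms
in `(1/30)ℤ`, or `ℚ`-valued local terms with unbounded denominators, are not excluded by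
Theorems 1–2 (for a divisible coefficient group Lemma 3, `Λ(F) = n • a`, is void), and loc. cit.,
Remark 14, removes bounded denominators only through the CONDITIONAL Theorems 9 and 13 ("by
increasing `d` by `k`"); unconditionally each further prime power in `m` costs one more witness
(e.g. `9 ∣ m` would follow from `rk E(F) ≢ 0 (mod 3)` over an `𝔽₃⁴`-extension `F/ℚ`, all of whose
decomposition groups have index `≡ 0 (mod 9)`).
[cite: DokchitserDokchitser2011RankModN, Remark 14 and proof of Thm. 2] -/
theorem thirty_dvd_of_isSumOfLocalInvariants_mul_rank
    (h₃ : DokchitserDokchitser2011_rank_480a1_F3) (h₄ : DokchitserDokchitser2011_rank_480a1_F4)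
    (h₅ : DokchitserDokchitser2011_rank_480a1_F5) (m : ℕ)
    (h : IsSumOfLocalInvariants
      (fun (K : Type) (_ : Field K) (_ : NumberField K) (W : WeierstrassCurve K) ↦
        (m : ℤ) * (W.mordellWeilRank : ℤ))) :
    30 ∣ m := by
  have d3 : (3 : ℤ) ∣ (m : ℤ) := by
    obtain ⟨F, _, _, hG, -, -, h₁, h₂, hr⟩ := h₃
    haveI := hG
    have := natCast_dvd_mul_mordellWeilRank_of_isSumOfLocalInvariants m h 3 ℚ F curve480a1 h₁ h₂
    rwa [hr, Nat.cast_one, mul_one] at this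
  have d4 : (4 : ℤ) ∣ (m : ℤ) * 6 := by
    obtain ⟨F, _, _, hG, -, -, h₁, h₂, hr⟩ := h₄
    haveI := hG
    have := natCast_dvd_mul_mordellWeilRank_of_isSumOfLocalInvariants m h 4 ℚ F curve480a1 h₁ h₂
    rwa [hr] at this
  have d5 : (5 : ℤ) ∣ (m : ℤ) := by
    obtain ⟨F, _, _, hG, -, -, h₁, h₂, hr⟩ := h₅
    haveI := hG
    have := natCast_dvd_mul_mordellWeilRank_of_isSumOfLocalInvariants m h 5 ℚ F curve480a1 h₁ h₂
    rwa [hr, Nat.cast_one, mul_one] at this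
  omega

end Literature.Barriers.BirchSwinnertonDyer

end
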